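import Summits.BirchSwinnertonDyer.BirchSwinnertonDyer.Theorems.ResidualThetaTransportAtTwoSignedMuSeedAtTwoPlusGrasLambdaFiniteIndex

/-!
# `M/fM` finite ⟹ `M[f]` finite for finitely generated `𝒪⟦X⟧`-modules (Γ-coinvariants control Γ-invariants)

Route `ResidualThetaTransportAtTwo`, seed crux `SignedMuSeedAtTwoPlus` (stmt-BirchSwinnertonDyer-21438). The
Iwasawa-module bookkeeping used by every (F)-line on the seed and by the lead's ε-test (census
`Cruxes/SignedMuSeedAtTwoPlus/IDEATION-CENSUS-k2g16.md` §2: «`A₀ = X/TX` finite ⇒ `T ∤ char X` ⇒ `X^Γ = X[T]`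
finite, hence inside the maximal finite submodule») is the following standard lemma, proved here WITHOUT the
structure theorem of `Λ`-modules (absent from Mathlib), for `Λ′ = 𝒪⟦X⟧` with `𝒪` a local PID with finite
residue field which is not a field (`ℤ_p`, `ℤ₂[ζ₃]`):

* `exists_pow_smul_eq_zero_of_finite` — in a FINITE module over a local ring, every element of the maximal
  ideal acts nilpotently (Artinian chain + Nakayama);
* `pow_smul_eq_zero_of_torsionBy` — the determinant trick: if `aⁿ M ⊆ f M` (`M` finitely generated) then a
  power of `a` kills `M[f]` (Cayley–Hamilton with coefficients in `(f)`,
  `LinearMap.exists_monic_and_natDegree_eq_and_coeff_mem_pow_and_aeval_eq_zero`);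
* `isUnit_of_dvd_X_pow_of_dvd_C_pow` — `X^a` and `C ϖ^b` (`ϖ ≠ 0`) have no common non-unit divisor in `𝒪⟦X⟧`;
* **`finite_torsionBy_of_finite_quotient`** — for `M` finitely generated over `𝒪⟦X⟧` and any `f`:
  `M/fM` finite ⟹ `M[f]` finite (the annihilator of `M[f]` contains powers of `X` and of `C ϖ`, hence is
  gcd-free, and `finite_of_annihilator_gcdFree` of `…GrasLambdaFiniteIndex` applies). With `f = T` (resp.
  `ω_n`): finiteness of the Γ-coinvariants forces finiteness of the Γ-invariants.

Nothing here proves BSD, the crux, the seed or (F); helper lemmas `--supports` the seed item. [folklore]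
(NSW (5.3.10)/(5.3.19)-type statements for `ℤ_p⟦T⟧`; Washington §13.2.)
-/

set_option autoImplicit false
set_option linter.dupNamespace false

namespace Summit.BirchSwinnertonDyer.BirchSwinnertonDyer.Theorems.SignedMuAtTwo.GrasLeopoldt

open PowerSeries IsLocalRing

/-- **In a finite module over a local ring every element of the maximal ideal acts nilpotently.** The
chain `aᵏ Q` stabilises (`Q` is Artinian, being finite) and Nakayama kills the stable term. [folklore] -/
theorem exists_pow_smul_eq_zero_of_finite {R : Type*} [CommRing R] [IsLocalRing R]
    (Q : Type*) [AddCommGroup Q] [Module R Q] [Finite Q] (a : R) (ha : a ∈ maximalIdeal R) :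
    ∃ n : ℕ, ∀ q : Q, a ^ n • q = 0 := by
  haveI : IsArtinian R Q := isArtinian_of_finite
  haveI : IsNoetherian R Q := isNoetherian_of_finite R Q
  set I : Ideal R := Ideal.span {a} with hI
  let g : ℕ →o (Submodule R Q)ᵒᵈ :=
    ⟨fun k => OrderDual.toDual (I ^ k • (⊤ : Submodule R Q)), fun i j hij =>
      OrderDual.toDual_le_toDual.mpr (Submodule.smul_mono_left (Ideal.pow_le_pow_right hij))⟩
  obtain ⟨n, hn⟩ := IsArtinian.monotone_stabilizes g
  have heq : I ^ n • (⊤ : Submodule R Q) = I ^ (n + 1) • ⊤ :=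
    congrArg OrderDual.ofDual (hn (n + 1) (Nat.le_succ n))
  have hIjac : I ≤ Ideal.jacobson ⊥ := by
    rw [IsLocalRing.jacobson_eq_maximalIdeal ⊥ bot_ne_top]
    exact (Ideal.span_singleton_le_iff_mem _).mpr ha
  have hbot : I ^ n • (⊤ : Submodule R Q) = ⊥ := by
    refine Submodule.eq_bot_of_le_smul_of_le_jacobson_bot I _ (IsNoetherian.noetherian _) ?_ hIjac
    rw [← Submodule.mul_smul, ← pow_succ']
    exact heq.le
  refine ⟨n, fun q => ?_⟩
  have : a ^ n • q ∈ I ^ n • (⊤ : Submodule R Q) :=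
    Submodule.smul_mem_smul (Ideal.pow_mem_pow (Ideal.mem_span_singleton_self a) n) Submodule.mem_top
  rw [hbot] at this
  exact (Submodule.mem_bot R).mp this

/-- **The determinant trick.** `M` finitely generated over a commutative ring `R`, `a, f ∈ R` with
`a • M ⊆ f • M`. Then some power of `a` kills the `f`-torsion `M[f]`: by Cayley–Hamilton there is a monic
`p` with `p(a) M = 0` and non-leading coefficients in `(f)`, so `a^{deg p} x = p(a) x − (f-multiple) x = 0`
whenever `f x = 0`. [folklore] -/
theorem pow_smul_eq_zero_of_torsionBy {R : Type*} [CommRing R] (M : Type*) [AddCommGroup M]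
    [Module R M] [Module.Finite R M] (a f : R)
    (h : ∀ x : M, a • x ∈ (Ideal.span {f} • (⊤ : Submodule R M))) :
    ∃ r : ℕ, ∀ x : M, f • x = 0 → a ^ r • x = 0 := by
  classical
  set φ : Module.End R M := algebraMap R (Module.End R M) a with hφ
  have hrange : LinearMap.range φ ≤ Ideal.span {f} • (⊤ : Submodule R M) := by
    rintro _ ⟨x, rfl⟩
    simpa [hφ, Module.algebraMap_end_apply] using h x
  obtain ⟨p, hmonic, -, hcoeff, hp⟩ :=
    LinearMap.exists_monic_and_natDegree_eq_and_coeff_mem_pow_and_aeval_eq_zero R φ _ hrange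
  refine ⟨p.natDegree, fun x hx => ?_⟩
  -- `p(a) • x = 0`
  have hpa : (Polynomial.eval a p) • x = 0 := by
    have := congrArg (fun ψ : Module.End R M => ψ x) hp
    simp only [hφ, Polynomial.aeval_algebraMap_apply, Polynomial.coe_aeval_eq_eval,
      Module.algebraMap_end_apply, LinearMap.zero_apply] at this
    exact this
  -- split off the leading term: `p(a) = a^r + (element of (f))`
  have hsum : Polynomial.eval a p =
      (∑ i ∈ Finset.range p.natDegree, p.coeff i * a ^ i) + a ^ p.natDegree := by
    rw [Polynomial.eval_eq_sum_range, Finset.sum_range_succ, hmonic.coeff_natDegree, one_mul]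
  have hlow : (∑ i ∈ Finset.range p.natDegree, p.coeff i * a ^ i) ∈ Ideal.span {f} := by
    refine Ideal.sum_mem _ fun i hi => Ideal.mul_mem_right _ _ ?_
    have hik : p.natDegree - i ≠ 0 := by
      have := Finset.mem_range.mp hi
      omega
    exact Ideal.pow_le_self hik (hcoeff i)
  obtain ⟨c, hc⟩ := Ideal.mem_span_singleton'.mp hlow
  have : a ^ p.natDegree • x = (Polynomial.eval a p) • x - (c * f) • x := by
    rw [hsum, hc, add_smul, add_sub_cancel_left]
  rw [this, hpa, mul_smul, hx, smul_zero, sub_zero]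

variable {𝒪 : Type*} [CommRing 𝒪] [IsDomain 𝒪]

/-- **`X^a` and `C ϖ^b` are coprime in `𝒪⟦X⟧`** (`𝒪` a domain, `ϖ ≠ 0`): a common divisor is associated to a
power `X^i` (`X` is prime), and `X ∣ C ϖ^b` forces `ϖ^b = 0`. [folklore] -/
theorem isUnit_of_dvd_X_pow_of_dvd_C_pow (ϖ : 𝒪) (hϖ : ϖ ≠ 0) (a b : ℕ) (p : 𝒪⟦X⟧)
    (h1 : p ∣ (X : 𝒪⟦X⟧) ^ a) (h2 : p ∣ (C ϖ : 𝒪⟦X⟧) ^ b) : IsUnit p := by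
  obtain ⟨i, -, hassoc⟩ := (dvd_prime_pow PowerSeries.X_prime a).mp h1
  rcases Nat.eq_zero_or_pos i with hi | hi
  · rw [hi, pow_zero] at hassoc
    exact associated_one_iff_isUnit.mp hassoc
  · exfalso
    have hX : (X : 𝒪⟦X⟧) ∣ (C ϖ : 𝒪⟦X⟧) ^ b :=
      (dvd_pow_self X hi.ne').trans (hassoc.symm.dvd.trans h2)
    rw [← map_pow, PowerSeries.X_dvd_iff, PowerSeries.constantCoeff_C] at hX
    exact hϖ (eq_zero_of_pow_eq_zero hX)

variable [IsPrincipalIdealRing 𝒪] [IsLocalRing 𝒪]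

/-- **`M/fM` finite ⟹ `M[f]` finite** for finitely generated `𝒪⟦X⟧`-modules, `𝒪` a local PID with finite
residue field, not a field (`ℤ_p`, `ℤ₂[ζ₃]`, …), and ANY `f ∈ 𝒪⟦X⟧`. Proof: `X` and `C ϖ` (`0 ≠ ϖ ∈ 𝔪_𝒪`) act
nilpotently on the finite module `M/fM` (`exists_pow_smul_eq_zero_of_finite`), so by the determinant trick
(`pow_smul_eq_zero_of_torsionBy`) powers of `X` and of `C ϖ` kill `M[f]`; these are coprime
(`isUnit_of_dvd_X_pow_of_dvd_C_pow`), so the annihilator of the finitely generated module `M[f]` is gcd-free and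
`finite_of_annihilator_gcdFree` (…GrasLambdaFiniteIndex) gives finiteness. For the seed lines: with `f = T`
(resp. `ω_n`, `ν_n`) this is «`X/TX = A₀` finite ⟹ `X^Γ = X[T]` finite» (census k2 g16 §2), i.e. the
Γ-coinvariants control the Γ-invariants, with no structure theorem. [folklore] -/
theorem finite_torsionBy_of_finite_quotient [Finite (ResidueField 𝒪)] (h𝒪 : ¬ IsField 𝒪)
    (M : Type*) [AddCommGroup M] [Module 𝒪⟦X⟧ M] [Module.Finite 𝒪⟦X⟧ M] (f : 𝒪⟦X⟧)
    (hfin : Finite (M ⧸ (Ideal.span {f} • (⊤ : Submodule 𝒪⟦X⟧ M)))) :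
    Finite (Submodule.torsionBy 𝒪⟦X⟧ M f) := by
  -- a non-zero element of the maximal ideal of `𝒪`
  obtain ⟨ϖ, hϖm, hϖ0⟩ : ∃ ϖ ∈ maximalIdeal 𝒪, ϖ ≠ 0 := by
    have hne : maximalIdeal 𝒪 ≠ ⊥ := fun h => h𝒪 (IsLocalRing.isField_iff_maximalIdeal_eq.mpr h)
    exact Submodule.exists_mem_ne_zero_of_ne_bot hne
  -- both `X` and `C ϖ` lie in the maximal ideal of `𝒪⟦X⟧`
  have hXm : (PowerSeries.X : 𝒪⟦X⟧) ∈ maximalIdeal 𝒪⟦X⟧ := by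
    rw [mem_maximalIdeal_powerSeries_iff, PowerSeries.constantCoeff_X]
    exact (maximalIdeal 𝒪).zero_mem
  have hCm : (PowerSeries.C ϖ : 𝒪⟦X⟧) ∈ maximalIdeal 𝒪⟦X⟧ := by
    rw [mem_maximalIdeal_powerSeries_iff, PowerSeries.constantCoeff_C]
    exact hϖm
  -- nilpotent action on the finite quotient, then the determinant trick
  haveI := hfin
  have key : ∀ a ∈ maximalIdeal 𝒪⟦X⟧, ∃ r : ℕ, ∀ x : M, f • x = 0 → a ^ r • x = 0 := by
    intro a ha
    obtain ⟨n, hn⟩ :=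
      exists_pow_smul_eq_zero_of_finite (M ⧸ (Ideal.span {f} • (⊤ : Submodule 𝒪⟦X⟧ M))) a ha
    have h' : ∀ x : M, a ^ n • x ∈ Ideal.span {f} • (⊤ : Submodule 𝒪⟦X⟧ M) := fun x => by
      have := hn (Submodule.Quotient.mk x)
      rw [← Submodule.Quotient.mk_smul, Submodule.Quotient.mk_eq_zero] at this
      exact this
    obtain ⟨r, hr⟩ := pow_smul_eq_zero_of_torsionBy M (a ^ n) f h'
    exact ⟨n * r, fun x hx => by rw [pow_mul]; exact hr x hx⟩
  obtain ⟨r₁, h₁⟩ := key _ hXm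
  obtain ⟨r₂, h₂⟩ := key _ hCm
  -- the annihilator of `M[f]` contains `X ^ r₁` and `(C ϖ) ^ r₂`, hence is gcd-free
  have hmem : ∀ a : 𝒪⟦X⟧, (∀ x : M, f • x = 0 → a • x = 0) →
      a ∈ Module.annihilator 𝒪⟦X⟧ (Submodule.torsionBy 𝒪⟦X⟧ M f) := fun a ha => by
    rw [Module.mem_annihilator]
    rintro ⟨x, hx⟩
    exact Subtype.ext (ha x (by simpa using hx))
  exact finite_of_annihilator_gcdFree (Submodule.torsionBy 𝒪⟦X⟧ M f) fun p hp =>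
    isUnit_of_dvd_X_pow_of_dvd_C_pow ϖ hϖ0 r₁ r₂ p (hp _ (hmem _ h₁)) (hp _ (hmem _ h₂))

/-- **Γ-coinvariants control Γ-invariants, submodule form.** Same statement with the conclusion as a
`Set.Finite` of `{x | f • x = 0}`, the shape used when `X[T]` is compared with the maximal finite submodule
(every finite `Λ′`-stable subset lies in it). [folklore] -/
theorem setOf_smul_eq_zero_finite_of_finite_quotient [Finite (ResidueField 𝒪)] (h𝒪 : ¬ IsField 𝒪)
    (M : Type*) [AddCommGroup M] [Module 𝒪⟦X⟧ M] [Module.Finite 𝒪⟦X⟧ M] (f : 𝒪⟦X⟧)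
    (hfin : Finite (M ⧸ (Ideal.span {f} • (⊤ : Submodule 𝒪⟦X⟧ M)))) :
    {x : M | f • x = 0}.Finite := by
  haveI := finite_torsionBy_of_finite_quotient h𝒪 M f hfin
  have : {x : M | f • x = 0} = (Submodule.torsionBy 𝒪⟦X⟧ M f : Set M) := by
    ext x
    simp
  rw [this]
  exact Set.toFinite _

end Summit.BirchSwinnertonDyer.BirchSwinnertonDyer.Theorems.SignedMuAtTwo.GrasLeopoldt
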